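import Summits.Langlands.Langlands.Theses.SplitPrimeInduction
import Literature.Algebra.Homology.GroupCohomologyCentralElement
import Literature.NumberTheory.NumberFields.PureCubicDegreeOnePrimes

/-!
# Disproof of `MonomialSerreAtSplitPrimes` (stmt-Langlands-16951) — findings: the crux is FALSE (refuted-misstated)

Single-file, kernel-checked (rc 0, no `sorry`, axioms `propext, Classical.choice, Quot.sound`) proof of

  `Summit.Langlands.Langlands.Cruxes.MonomialSerreAtSplitPrimes.Disproof.monomialSerreAtSplitPrimes_false :
     ¬ Summit.Langlands.Langlands.Theses.SplitPrimeInduction.MonomialSerreAtSplitPrimes`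

(namespace `…Cruxes.MonomialSerreAtSplitPrimes.Disproof` here; the gate copies use
`…Theorems.MonomialSerreAtSplitPrimes.Negative` and `…Theorems.SplitPrimeInductionMonomialSerreAtSplitPrimes_refuted`)

by the refuter seat `rattack-stmt-Langlands-16951` (crux attack at birth, 2026-08-17).  The same content
is being landed through the gate as the chain `Theorems/MonomialSerreAtSplitPrimes/Negative/
{CentralHeckeNeighbourhoods, RatPlacesTestIdele, FalseOfCubicField, PureCubicPrimes, PureCubicTwoSplitData}.lean`
+ `Theorems/SplitPrimeInductionMonomialSerreAtSplitPrimesRefutation.lean`.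

WITNESS: `F = ℚ(∛2)` (`AdjoinRoot (X³ - 2)`, `d = 3`, `r₁ = 1`), `p = 31` (completely split:
`x³ - 2 ≡ (x-4)(x-7)(x-20)`), `k = 𝔽̄₃₁` discrete, `χ = 1`, `Sχ = ∅`, `c ≡ 1`.
MECHANISM (the planner's `RefutationSketch.md`, sharpened to ONE Dirichlet prime, no character theory):
§1 the Hecke operator of a principal scalar finite idèle is the identity on the tree's
`H^i(X_L, M) = H^i(Γ, Fun(𝒢/L, M))` (central elements act trivially on group cohomology); §2 Hecke
operators only see the coset `gK'`, and the top Hecke element is the scalar of the local idèle; §3 an open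
`K' ∋ 1` contains all scalars `y·1` with `y, y⁻¹` integral and `≡ 1` to prescribed depth at finitely many
places (restricted product topology); §4 for `ℓ ≡ -1 (mod 31·M₀·∏ q_v^{N_v+1})` the idèle
`y = (-ℓ)⁻¹ϖ_ℓ` qualifies, so `T^{(3)}_ℓ e = T_{(-ℓ)·1} e = e`, `b_{ℓ,3} = 1`; §5–6 the `X³`-coefficient of
`P_ℓ(b) = ∏_{w∣ℓ}(1 - X^{f_w})` at a prime of splitting type `(1,2)` is `-ℓ⁶ b_{ℓ,3} = +1`, i.e. `-1 = 1`
in `𝔽̄₃₁`; §7–12 the arithmetic of `ℚ(∛2)` (Dedekind–Kummer from the tree's pure-cubic files and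
Mathlib `primesOverSpanEquivMonicFactorsMod`; `r₁ ≤ 1` by uniqueness of the real cube root).
CLASS: refuted-MISSTATED.  Repaired statement `C′`: insert `χ.IsOdd →` after the binder `c` — literally the
planner's `Cruxes/MonomialSerreAtSplitPrimes/Lines/birth.lean` `Birth.MonomialSerreAtSplitPrimesOdd`; the
witness (`χ = 1`, even at the real place) misses `C′`.
-/

noncomputable section

set_option linter.dupNamespace false

open scoped NumberField Classical Polynomial Topology RestrictedProduct
open IsDedekindDomain NumberField Polynomial Filter
open Literature.NumberTheory.Automorphic Literature.NumberTheory.GaloisRepresentations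

namespace Summit.Langlands.Langlands.Cruxes.MonomialSerreAtSplitPrimes.Disproof

/-! ## 1. Hecke operators of central elements (after the planner's `Lines/birth.lean` §6) -/

section Central

universe u

variable (k : Type u) [CommRing k] {Γ 𝒢 : Type u} [Group Γ] [Group 𝒢]
  (ι : Γ →* 𝒢) (L : Subgroup 𝒢) (M : Type u) [AddCommGroup M] [Module k M]

omit [Group Γ] in
variable {k ι M} in
/-- For `g` central in `𝒢`, the double coset `L g L / L` is the single coset `gL`. [folklore] -/
theorem doubleCosetQuot_of_mem_center {g : 𝒢} (hg : g ∈ Subgroup.center 𝒢) :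
    ArithmeticQuotient.doubleCosetQuot L g = {(g : 𝒢 ⧸ L)} := by
  ext d
  simp only [Set.mem_singleton_iff, ArithmeticQuotient.doubleCosetQuot]
  constructor
  · rintro ⟨m, rfl⟩
    show ((m : 𝒢) • (g : 𝒢 ⧸ L)) = _
    rw [MulAction.Quotient.smul_coe, smul_eq_mul, Subgroup.mem_center_iff.1 hg (m : 𝒢)]
    exact QuotientGroup.eq.mpr (by simp)
  · rintro rfl
    exact MulAction.mem_orbit_self _

omit [Group Γ] in
variable {ι} in
/-- For `g` central in `𝒢`, `T_g = [L g L]` on `Fun(𝒢 ⧸ L, M)` is the translation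
`(T_g f)(c) = f(g • c)`. [folklore] -/
theorem heckeFun_apply_of_mem_center {g : 𝒢} (hg : g ∈ Subgroup.center 𝒢) (f : (𝒢 ⧸ L) → M)
    (c : 𝒢 ⧸ L) : ArithmeticQuotient.heckeFun k L g M f c = f (g • c) := by
  classical
  have hfin : (ArithmeticQuotient.doubleCosetQuot L g).Finite := by
    rw [doubleCosetQuot_of_mem_center L hg]
    exact Set.finite_singleton _
  have hset : hfin.toFinset = {(g : 𝒢 ⧸ L)} :=
    Finset.ext fun d => by rw [Set.Finite.mem_toFinset, doubleCosetQuot_of_mem_center L hg]; simp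
  rw [ArithmeticQuotient.heckeFun_apply, dif_pos hfin, hset, Finset.sum_singleton,
    MulAction.Quotient.smul_coe, smul_eq_mul, Subgroup.mem_center_iff.1 hg c.out]
  congr 1
  conv_rhs => rw [← QuotientGroup.out_eq' c]
  rfl

/-- **Central elements of `Γ` act trivially through their Hecke operators.**  If `γ ∈ Z(Γ)` and
`ι γ ∈ Z(𝒢)`, then `T_{ι γ} = [L (ι γ) L]` is the identity of `H^i(X_L, M) = H^i(Γ, Fun(𝒢 ⧸ L, M))`:
on coefficients `T_{ιγ} f = f(ιγ • ·) = ρ(γ⁻¹) f`, and `γ⁻¹ ∈ Z(Γ)` acts trivially on group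
cohomology. [cite: SerreLocalFields1979, Ch. VII §5, Prop. 3] -/
theorem heckeEnd_apply_of_mem_center {γ : Γ} (hγ : γ ∈ Subgroup.center Γ)
    (hιγ : ι γ ∈ Subgroup.center 𝒢) (i : ℕ) (x : ArithmeticQuotient.cohomology k ι L M i) :
    ArithmeticQuotient.heckeEnd k L (ι γ) M ι i x = x := by
  refine Literature.Algebra.Homology.map_apply_eq_self_of_central (ArithmeticQuotient.coeffRep k ι L M)
    (Subgroup.inv_mem _ hγ) (ArithmeticQuotient.heckeRepHom k L (ι γ) M ι) (fun f => ?_) i x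
  change ArithmeticQuotient.heckeFun k L (ι γ) M f = ArithmeticQuotient.coeffRepresentation k ι L M γ⁻¹ f
  ext c
  rw [heckeFun_apply_of_mem_center k L M hιγ, ArithmeticQuotient.coeffRepresentation_apply, map_inv,
    inv_inv]

/-- Scalar matrices are central in `GL_n(R)` (Mathlib `Matrix.GeneralLinearGroup.center_eq_range_scalar`).
[folklore] -/
theorem scalar_mem_center (n : ℕ) (R : Type u) [CommRing R] (r : Rˣ) :
    Matrix.GeneralLinearGroup.scalar (Fin n) r ∈ Subgroup.center (GL (Fin n) R) := by
  rw [Matrix.GeneralLinearGroup.center_eq_range_scalar]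
  exact ⟨r, rfl⟩

/-- **Central sign lemma for `GL_n` over a number field**: the Hecke operator of a principal scalar
finite idèle `r·1`, `r ∈ F^×`, is the identity on `H^i(X_K, M)`.
[cite: SerreLocalFields1979, Ch. VII §5, Prop. 3] -/
theorem heckeEnd_principalScalar_apply (n : ℕ) (F : Type) [Field F] [NumberField F] (k : Type)
    [CommRing k] (K : Subgroup (GL (Fin n) (FiniteAdeleRing (𝓞 F) F))) (M : Type) [AddCommGroup M]
    [Module k M] (r : Fˣ) (i : ℕ) (x : ArithmeticQuotient.cohomology k
      (Matrix.GeneralLinearGroup.map (algebraMap F (FiniteAdeleRing (𝓞 F) F))) K M i) :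
    ArithmeticQuotient.heckeEnd k K
      (Matrix.GeneralLinearGroup.map (algebraMap F (FiniteAdeleRing (𝓞 F) F))
        (Matrix.GeneralLinearGroup.scalar (Fin n) r)) M
      (Matrix.GeneralLinearGroup.map (algebraMap F (FiniteAdeleRing (𝓞 F) F))) i x = x :=
  heckeEnd_apply_of_mem_center k _ K M (scalar_mem_center n F r)
    (by rw [Matrix.GeneralLinearGroup.map_scalar]; exact scalar_mem_center _ _ _) i x

/-! ## 2. Hecke operators only see the coset `gL`; the top Hecke element is a central scalar -/

omit [Group Γ] in
variable {k M} in
/-- `[L g L]` depends only on the coset `g L`: if `g L = g' L` then `T_g = T_{g'}`. [folklore] -/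
theorem heckeFun_eq_of_coe_eq {g g' : 𝒢} (h : (g : 𝒢 ⧸ L) = g') :
    ArithmeticQuotient.heckeFun k L g M = ArithmeticQuotient.heckeFun k L g' M := by
  have hq : ArithmeticQuotient.doubleCosetQuot L g = ArithmeticQuotient.doubleCosetQuot L g' := by
    simp only [ArithmeticQuotient.doubleCosetQuot, h]
  refine LinearMap.ext fun f => funext fun c => ?_
  rw [ArithmeticQuotient.heckeFun_apply, ArithmeticQuotient.heckeFun_apply, hq]

variable {k M} in
/-- Hence the Hecke operators on `H^i(X_L, M)` of `g` and `g'` agree when `g L = g' L`. [folklore] -/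
theorem heckeEnd_eq_of_coe_eq {g g' : 𝒢} (h : (g : 𝒢 ⧸ L) = g') (i : ℕ) :
    ArithmeticQuotient.heckeEnd k L g M ι i = ArithmeticQuotient.heckeEnd k L g' M ι i := by
  have : ArithmeticQuotient.heckeRepHom k L g M ι = ArithmeticQuotient.heckeRepHom k L g' M ι :=
    Rep.hom_ext (Representation.IntertwiningMap.ext (heckeFun_eq_of_coe_eq L h))
  simp only [ArithmeticQuotient.heckeEnd, ArithmeticQuotient.heckeOperator, this]

end Central

/-- The top Hecke element `t_{v,n} = diag(ϖ_v, …, ϖ_v)` (all `n` slots) projects to the central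
scalar `ϖ_v · 1 ∈ GL_n(𝔸_K^∞)` of the local idèle of `ϖ_v`. [folklore] -/
theorem sndHom_heckeDiagAt_self (n : ℕ) (K : Type) [Field K] [NumberField K]
    (v : HeightOneSpectrum (𝓞 K)) (ϖ : (v.adicCompletion K)ˣ) :
    GLn.sndHom n K (heckeDiagAt n K v ϖ n) =
      Matrix.GeneralLinearGroup.scalar (Fin n) (uniformizerIdele K v ϖ) := by
  refine Matrix.GeneralLinearGroup.ext fun i j => ?_
  change ((heckeDiagAt n K v ϖ n : GL (Fin n) (AdeleRing (𝓞 K) K)) i j).2 =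
    Matrix.scalar (Fin n) ((uniformizerIdele K v ϖ : (FiniteAdeleRing (𝓞 K) K)ˣ) :
      FiniteAdeleRing (𝓞 K) K) i j
  rw [heckeDiagAt, coe_glDiagonal, Matrix.scalar_apply, Matrix.diagonal_apply, Matrix.diagonal_apply]
  by_cases h : i = j
  · subst h
    simp [i.isLt]
  · simp only [h, if_false]
    rfl

/-! ## 3. Neighbourhoods of `1` in `𝔸_K^∞`, in its unit group, and in `GL_n(𝔸_K^∞)` -/

section Nbhd

variable (K : Type) [Field K] [NumberField K]

/-- In a valued ring, a neighbourhood of `0` contains an open ball `{v < γ}`, `γ ≠ 0`, of the value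
group. [folklore] -/
theorem exists_ball_subset_of_mem_nhds_zero {R : Type} [CommRing R] {Γ₀ : Type}
    [LinearOrderedCommGroupWithZero Γ₀] [hv : Valued R Γ₀] {s : Set R} (hs : s ∈ 𝓝 (0 : R)) :
    ∃ γ : Γ₀, γ ≠ 0 ∧ ∀ x : R, Valued.v x < γ → x ∈ s := by
  obtain ⟨γ, hγ⟩ := (Valued.mem_nhds_zero (R := R)).1 hs
  refine ⟨MonoidWithZeroHom.ValueGroup₀.embedding γ.1, ?_, fun x hx => hγ ?_⟩
  · intro h0
    apply γ.ne_zero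
    apply MonoidWithZeroHom.ValueGroup₀.embedding_strictMono.injective
    rw [h0, map_zero]
  · exact (Valuation.restrict_lt_iff_lt_embedding _).2 hx

/-- **Neighbourhoods of `1` in the finite adèle ring.**  A neighbourhood `W` of `1` in `𝔸_K^∞`
contains every integral finite adèle that is `v`-adically close to `1` at finitely many places `v`
(restricted product topology: `∏_v 𝒪_v` is an open subspace carrying the product topology).
[folklore] -/
theorem exists_forall_mem_of_mem_nhds_one {W : Set (FiniteAdeleRing (𝓞 K) K)}
    (hW : W ∈ 𝓝 (1 : FiniteAdeleRing (𝓞 K) K)) :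
    ∃ (I : Set (HeightOneSpectrum (𝓞 K))) (_ : I.Finite) (γ : HeightOneSpectrum (𝓞 K) → WithZero (Multiplicative ℤ)),
      (∀ v, γ v ≠ 0) ∧ ∀ a : FiniteAdeleRing (𝓞 K) K, (∀ v, a v ∈ v.adicCompletionIntegers K) →
        (∀ v ∈ I, Valued.v (a v - 1) < γ v) → a ∈ W := by
  -- the structure map `∏_v 𝒪_v → 𝔸_K^∞` and the point `1`
  let A : (v : HeightOneSpectrum (𝓞 K)) → Set (v.adicCompletion K) :=
    fun v => (v.adicCompletionIntegers K : Set (v.adicCompletion K))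
  have hAopen : ∀ v, IsOpen (A v) := fun v => Valued.isOpen_valuationSubring _
  let one' : (v : HeightOneSpectrum (𝓞 K)) → A v := fun v => ⟨1, one_mem _⟩
  have h1 : RestrictedProduct.structureMap (fun v : HeightOneSpectrum (𝓞 K) => v.adicCompletion K)
      A cofinite one' = (1 : FiniteAdeleRing (𝓞 K) K) :=
    Subtype.ext (funext fun v => rfl)
  have hW' : W ∈ 𝓝 (RestrictedProduct.structureMap
      (fun v : HeightOneSpectrum (𝓞 K) => v.adicCompletion K) A cofinite one') := by
    rw [h1]; exact hW
  rw [RestrictedProduct.nhds_eq_map_structureMap hAopen one'] at hW'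
  have hW'' : (RestrictedProduct.structureMap
      (fun v : HeightOneSpectrum (𝓞 K) => v.adicCompletion K) A cofinite) ⁻¹' W ∈ 𝓝 one' := hW'
  rw [nhds_pi, Filter.mem_pi] at hW''
  obtain ⟨I, hI, t, ht, hts⟩ := hW''
  -- at each place, `t v` contains a valuation ball around `1`
  have key : ∀ v, ∃ γ : WithZero (Multiplicative ℤ), γ ≠ 0 ∧ ∀ y : v.adicCompletion K, ∀ hy : y ∈ A v,
      Valued.v (y - 1) < γ → (⟨y, hy⟩ : A v) ∈ t v := by
    intro v
    have htv := ht v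
    rw [nhds_induced, Filter.mem_comap] at htv
    obtain ⟨u, hu, hut⟩ := htv
    have hu0 : (fun y => y + 1) ⁻¹' u ∈ 𝓝 (0 : v.adicCompletion K) := by
      refine (continuous_add_const (1 : v.adicCompletion K)).continuousAt.preimage_mem_nhds ?_
      simpa using hu
    obtain ⟨γ, hγ0, hγ⟩ := exists_ball_subset_of_mem_nhds_zero hu0
    refine ⟨γ, hγ0, fun y hy hlt => hut ?_⟩
    have := hγ (y - 1) hlt
    simpa using this
  choose γ hγ0 hγ using key
  refine ⟨I, hI, γ, hγ0, fun a ha hclose => ?_⟩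
  let x : (v : HeightOneSpectrum (𝓞 K)) → A v := fun v => ⟨a v, ha v⟩
  have hx : RestrictedProduct.structureMap (fun v : HeightOneSpectrum (𝓞 K) => v.adicCompletion K)
      A cofinite x = a := Subtype.ext (funext fun v => rfl)
  have hmem : x ∈ I.pi t := fun v hv => hγ v (a v) (ha v) (hclose v hv)
  have := hts hmem
  rwa [Set.mem_preimage, hx] at this

/-- **Neighbourhoods of `1` in the finite idèle group** (unit topology): a neighbourhood of `1` in
`(𝔸_K^∞)ˣ` contains every unit `y` with `y, y⁻¹` integral everywhere and `v`-adically close to `1`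
at finitely many places. [folklore] -/
theorem exists_forall_mem_of_mem_nhds_one_units {W : Set (FiniteAdeleRing (𝓞 K) K)ˣ}
    (hW : W ∈ 𝓝 (1 : (FiniteAdeleRing (𝓞 K) K)ˣ)) :
    ∃ (I : Set (HeightOneSpectrum (𝓞 K))) (_ : I.Finite) (γ : HeightOneSpectrum (𝓞 K) → WithZero (Multiplicative ℤ)),
      (∀ v, γ v ≠ 0) ∧ ∀ y : (FiniteAdeleRing (𝓞 K) K)ˣ,
        (∀ v, (y : FiniteAdeleRing (𝓞 K) K) v ∈ v.adicCompletionIntegers K ∧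
          ((y⁻¹ : (FiniteAdeleRing (𝓞 K) K)ˣ) : FiniteAdeleRing (𝓞 K) K) v ∈
            v.adicCompletionIntegers K) →
        (∀ v ∈ I, Valued.v ((y : FiniteAdeleRing (𝓞 K) K) v - 1) < γ v ∧
          Valued.v (((y⁻¹ : (FiniteAdeleRing (𝓞 K) K)ˣ) : FiniteAdeleRing (𝓞 K) K) v - 1) < γ v) →
        y ∈ W := by
  rw [nhds_induced, Filter.mem_comap] at hW
  obtain ⟨V, hV, hVW⟩ := hW
  rw [Units.embedProduct_apply, inv_one, Units.val_one, MulOpposite.op_one,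
    mem_nhds_prod_iff] at hV
  obtain ⟨V₁, hV₁, V₂, hV₂, hV12⟩ := hV
  rw [← MulOpposite.op_one, ← MulOpposite.map_op_nhds, Filter.mem_map] at hV₂
  obtain ⟨I₁, hI₁, γ₁, hγ₁0, h₁⟩ := exists_forall_mem_of_mem_nhds_one K hV₁
  obtain ⟨I₂, hI₂, γ₂, hγ₂0, h₂⟩ := exists_forall_mem_of_mem_nhds_one K hV₂
  refine ⟨I₁ ∪ I₂, hI₁.union hI₂, fun v => min (γ₁ v) (γ₂ v), fun v => ?_, fun y hint hclose => ?_⟩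
  · show min (γ₁ v) (γ₂ v) ≠ 0
    rcases min_choice (γ₁ v) (γ₂ v) with h | h <;> rw [h]
    · exact hγ₁0 v
    · exact hγ₂0 v
  · apply hVW
    rw [Set.mem_preimage, Units.embedProduct_apply]
    refine hV12 (Set.mk_mem_prod ?_ ?_)
    · exact h₁ _ (fun v => (hint v).1) fun v hv =>
        (hclose v (Or.inl hv)).1.trans_le (min_le_left _ _)
    · exact h₂ _ (fun v => (hint v).2) fun v hv =>
        (hclose v (Or.inr hv)).2.trans_le (min_le_right _ _)

/-- The scalar embedding `(𝔸_K^∞)ˣ → GL_n(𝔸_K^∞)` is continuous. [folklore] -/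
theorem continuous_scalar (n : ℕ) :
    Continuous (Matrix.GeneralLinearGroup.scalar (Fin n) :
      (FiniteAdeleRing (𝓞 K) K)ˣ → GL (Fin n) (FiniteAdeleRing (𝓞 K) K)) := by
  refine Units.continuous_map ?_
  change Continuous fun a : FiniteAdeleRing (𝓞 K) K => Matrix.scalar (Fin n) a
  simp_rw [Matrix.scalar_apply]
  exact (continuous_pi fun _ => continuous_id).matrix_diagonal

/-- **Open subsets of `GL_n(𝔸_K^∞)` containing `1` contain all scalar units close to `1`:** if `U`
is open with `1 ∈ U`, there are finitely many places `I` and bounds `γ_v ≠ 0` such that every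
finite idèle `y` with `y, y⁻¹` integral everywhere and `v(y_v - 1), v(y_v⁻¹ - 1) < γ_v` for
`v ∈ I` has `y · 1 ∈ U`. [folklore] -/
theorem exists_forall_scalar_mem {n : ℕ} {U : Set (GL (Fin n) (FiniteAdeleRing (𝓞 K) K))}
    (hU : IsOpen U) (h1 : (1 : GL (Fin n) (FiniteAdeleRing (𝓞 K) K)) ∈ U) :
    ∃ (I : Set (HeightOneSpectrum (𝓞 K))) (_ : I.Finite) (γ : HeightOneSpectrum (𝓞 K) → WithZero (Multiplicative ℤ)),
      (∀ v, γ v ≠ 0) ∧ ∀ y : (FiniteAdeleRing (𝓞 K) K)ˣ,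
        (∀ v, (y : FiniteAdeleRing (𝓞 K) K) v ∈ v.adicCompletionIntegers K ∧
          ((y⁻¹ : (FiniteAdeleRing (𝓞 K) K)ˣ) : FiniteAdeleRing (𝓞 K) K) v ∈
            v.adicCompletionIntegers K) →
        (∀ v ∈ I, Valued.v ((y : FiniteAdeleRing (𝓞 K) K) v - 1) < γ v ∧
          Valued.v (((y⁻¹ : (FiniteAdeleRing (𝓞 K) K)ˣ) : FiniteAdeleRing (𝓞 K) K) v - 1) < γ v) →
        Matrix.GeneralLinearGroup.scalar (Fin n) y ∈ U := by
  have hW : (Matrix.GeneralLinearGroup.scalar (Fin n) :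
      (FiniteAdeleRing (𝓞 K) K)ˣ → GL (Fin n) (FiniteAdeleRing (𝓞 K) K)) ⁻¹' U ∈
        𝓝 (1 : (FiniteAdeleRing (𝓞 K) K)ˣ) :=
    (hU.preimage (continuous_scalar K n)).mem_nhds (by simpa using h1)
  obtain ⟨I, hI, γ, hγ0, h⟩ := exists_forall_mem_of_mem_nhds_one_units K hW
  exact ⟨I, hI, γ, hγ0, fun y hint hclose => h y hint hclose⟩

end Nbhd


/-! ## 4. Places of `ℚ` at rational primes; the test idèle `y = (-ℓ)⁻¹ · ϖ_v` -/

section RatPlaces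

/-- `N((ℓ)) = ℓ` in `𝓞 ℚ`. [folklore] -/
theorem absNorm_span_natCast (ℓ : ℕ) : Ideal.absNorm (Ideal.span {(ℓ : 𝓞 ℚ)}) = ℓ := by
  rw [Ideal.absNorm_span_singleton, show ((ℓ : ℕ) : 𝓞 ℚ) = algebraMap ℤ (𝓞 ℚ) (ℓ : ℤ) by simp,
    Algebra.norm_algebraMap, RingOfIntegers.rank, Module.finrank_self, pow_one, Int.natAbs_natCast]

/-- For a rational prime `ℓ`, the ideal `(ℓ) ⊂ 𝓞 ℚ` is a nonzero prime (its norm `ℓ` is prime), i.e.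
a finite place of `ℚ` (`HeightOneSpectrum.ofPrime`). [folklore] -/
theorem prime_span_natCast {ℓ : ℕ} (hℓ : ℓ.Prime) : Prime (Ideal.span {(ℓ : 𝓞 ℚ)}) :=
  Ideal.prime_of_isPrime
    (by rw [Ne, Ideal.span_singleton_eq_bot]; exact_mod_cast hℓ.ne_zero)
    (Ideal.isPrime_of_irreducible_absNorm (by rw [absNorm_span_natCast]; exact hℓ))

/-- The valuation of a natural number at a place of `ℚ` is its integral valuation. [folklore] -/
theorem valuation_natCast (w : HeightOneSpectrum (𝓞 ℚ)) (n : ℕ) :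
    w.valuation ℚ (n : ℚ) = w.intValuation (n : 𝓞 ℚ) := by
  rw [show (n : ℚ) = algebraMap (𝓞 ℚ) ℚ (n : 𝓞 ℚ) by rw [map_natCast]]
  exact HeightOneSpectrum.valuation_of_algebraMap w (n : 𝓞 ℚ)

/-- If `m ∈ 𝔭_w^n` then `v_w(m) ≤ exp(-n)`. [folklore] -/
theorem valuation_natCast_le_of_mem_pow {w : HeightOneSpectrum (𝓞 ℚ)} {m n : ℕ}
    (h : (m : 𝓞 ℚ) ∈ w.asIdeal ^ n) : w.valuation ℚ (m : ℚ) ≤ WithZero.exp (-(n : ℤ)) := by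
  rw [valuation_natCast]
  exact (HeightOneSpectrum.intValuation_le_pow_iff_mem _ _ _).2 h

/-- The valuation of the diagonal image of `q ∈ ℚ` at `w` is `v_w(q)`. [folklore] -/
theorem valued_algebraMap_apply (w : HeightOneSpectrum (𝓞 ℚ)) (q : ℚ) :
    Valued.v (algebraMap ℚ (FiniteAdeleRing (𝓞 ℚ) ℚ) q w) = w.valuation ℚ q := by
  rw [IsDedekindDomain.FiniteAdeleRing.algebraMap_apply]
  exact HeightOneSpectrum.valuedAdicCompletion_eq_valuation' w q

/-- `(q)_w - 1 = (q - 1)_w`. [folklore] -/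
theorem algebraMap_apply_sub_one (w : HeightOneSpectrum (𝓞 ℚ)) (q : ℚ) :
    algebraMap ℚ (FiniteAdeleRing (𝓞 ℚ) ℚ) q w - 1 = algebraMap ℚ (FiniteAdeleRing (𝓞 ℚ) ℚ) (q - 1) w := by
  rw [map_sub, map_one]
  rfl

variable {ℓ : ℕ} (hℓ : ℓ.Prime) {v : HeightOneSpectrum (𝓞 ℚ)}
  (hv : v.asIdeal = Ideal.span {(ℓ : 𝓞 ℚ)})

include hv in
/-- `q_{(ℓ)} = ℓ`. [folklore] -/
theorem residueCard_eq_of_asIdeal_eq : v.residueCard = ℓ := by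
  show Ideal.absNorm v.asIdeal = ℓ
  rw [hv, absNorm_span_natCast]

include hv in
/-- `ℓ ∈ (ℓ)`. [folklore] -/
theorem natCast_mem_of_asIdeal_eq : (ℓ : 𝓞 ℚ) ∈ v.asIdeal :=
  hv ▸ Ideal.mem_span_singleton_self _

include hv in
/-- A place of `ℚ` containing `ℓ` is `(ℓ)` (maximality of `(ℓ)`). [folklore] -/
theorem eq_of_natCast_mem {w : HeightOneSpectrum (𝓞 ℚ)} (h : (ℓ : 𝓞 ℚ) ∈ w.asIdeal) : w = v := by
  have hle : v.asIdeal ≤ w.asIdeal := by rw [hv]; exact (Ideal.span_singleton_le_iff_mem _).2 h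
  exact HeightOneSpectrum.ext (v.isMaximal.eq_of_le w.isPrime.ne_top hle).symm

include hv in
/-- At a place `w ≠ (ℓ)`, `ℓ` is a unit: `v_w(ℓ) = 1`. [folklore] -/
theorem valuation_natCast_of_ne {w : HeightOneSpectrum (𝓞 ℚ)} (hw : w ≠ v) :
    w.valuation ℚ (ℓ : ℚ) = 1 := by
  rw [valuation_natCast, HeightOneSpectrum.intValuation_eq_one_iff]
  exact fun h => hw (eq_of_natCast_mem hv h)

include hℓ hv in
/-- At the place `(ℓ)`, `ℓ` is a uniformiser: `v_{(ℓ)}(ℓ) = exp(-1)`. [folklore] -/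
theorem valuation_natCast_self : v.valuation ℚ (ℓ : ℚ) = WithZero.exp (-1 : ℤ) := by
  rw [valuation_natCast]
  exact HeightOneSpectrum.intValuation_singleton _ (by exact_mod_cast hℓ.ne_zero) hv

variable (r : ℚˣ) (ϖ : (v.adicCompletion ℚ)ˣ)

omit hℓ in
/-- The local idèle of `ϖ` is `r · y`, `y = r⁻¹ · (ϖ at v, 1 elsewhere)` (the TEST IDÈLE). [folklore] -/
theorem uniformizerIdele_eq_mul :
    uniformizerIdele ℚ v ϖ =
      Units.map (algebraMap ℚ (FiniteAdeleRing (𝓞 ℚ) ℚ) : ℚ →* FiniteAdeleRing (𝓞 ℚ) ℚ) r *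
        ((Units.map (algebraMap ℚ (FiniteAdeleRing (𝓞 ℚ) ℚ) : ℚ →* FiniteAdeleRing (𝓞 ℚ) ℚ) r)⁻¹ *
          uniformizerIdele ℚ v ϖ) :=
  (mul_inv_cancel_left _ _).symm

omit hℓ in
/-- Components of the test idèle `y`: `y_w = (r⁻¹)_w · (ϖ at v, 1 elsewhere)_w`. [folklore] -/
theorem testIdele_apply (w : HeightOneSpectrum (𝓞 ℚ)) :
    (((Units.map (algebraMap ℚ (FiniteAdeleRing (𝓞 ℚ) ℚ) : ℚ →* FiniteAdeleRing (𝓞 ℚ) ℚ) r)⁻¹ *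
        uniformizerIdele ℚ v ϖ : (FiniteAdeleRing (𝓞 ℚ) ℚ)ˣ) : FiniteAdeleRing (𝓞 ℚ) ℚ) w =
      algebraMap ℚ (FiniteAdeleRing (𝓞 ℚ) ℚ) ((r : ℚ)⁻¹) w *
        (uniformizerIdele ℚ v ϖ : FiniteAdeleRing (𝓞 ℚ) ℚ) w := by
  rw [Units.val_mul, ← map_inv, Units.coe_map, Units.val_inv_eq_inv_val]
  rfl

omit hℓ in
/-- Components of `y⁻¹`: `y⁻¹_w = (ϖ⁻¹ at v, 1 elsewhere)_w · r_w`. [folklore] -/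
theorem testIdele_inv_apply (w : HeightOneSpectrum (𝓞 ℚ)) :
    (((((Units.map (algebraMap ℚ (FiniteAdeleRing (𝓞 ℚ) ℚ) : ℚ →* FiniteAdeleRing (𝓞 ℚ) ℚ) r)⁻¹ *
        uniformizerIdele ℚ v ϖ)⁻¹ : (FiniteAdeleRing (𝓞 ℚ) ℚ)ˣ)) : FiniteAdeleRing (𝓞 ℚ) ℚ) w =
      (uniformizerIdele ℚ v ϖ⁻¹ : FiniteAdeleRing (𝓞 ℚ) ℚ) w *
        algebraMap ℚ (FiniteAdeleRing (𝓞 ℚ) ℚ) (r : ℚ) w := by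
  rw [mul_inv_rev, inv_inv, map_inv, Units.val_mul, Units.coe_map]
  rfl

variable {r} (hr : (r : ℚ) = -(ℓ : ℚ))

include hℓ hv hr in
/-- For `r = -ℓ` and `ϖ` a uniformiser at `(ℓ)`, `y` and `y⁻¹` are integral at every place.
[folklore] -/
theorem testIdele_integral (hϖ : Valued.v ((ϖ : (v.adicCompletion ℚ)ˣ) : v.adicCompletion ℚ) =
      WithZero.exp (-1 : ℤ)) (w : HeightOneSpectrum (𝓞 ℚ)) :
    (((Units.map (algebraMap ℚ (FiniteAdeleRing (𝓞 ℚ) ℚ) : ℚ →* FiniteAdeleRing (𝓞 ℚ) ℚ) r)⁻¹ *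
        uniformizerIdele ℚ v ϖ : (FiniteAdeleRing (𝓞 ℚ) ℚ)ˣ) : FiniteAdeleRing (𝓞 ℚ) ℚ) w ∈
        w.adicCompletionIntegers ℚ ∧
      (((((Units.map (algebraMap ℚ (FiniteAdeleRing (𝓞 ℚ) ℚ) : ℚ →* FiniteAdeleRing (𝓞 ℚ) ℚ) r)⁻¹ *
        uniformizerIdele ℚ v ϖ)⁻¹ : (FiniteAdeleRing (𝓞 ℚ) ℚ)ˣ)) : FiniteAdeleRing (𝓞 ℚ) ℚ) w ∈
        w.adicCompletionIntegers ℚ := by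
  rw [HeightOneSpectrum.mem_adicCompletionIntegers, HeightOneSpectrum.mem_adicCompletionIntegers,
    testIdele_apply, testIdele_inv_apply, Valuation.map_mul, Valuation.map_mul,
    valued_algebraMap_apply, valued_algebraMap_apply, map_inv₀, hr, Valuation.map_neg]
  by_cases hw : w = v
  · subst hw
    rw [uniformizerIdele_apply_self, uniformizerIdele_apply_self, valuation_natCast_self hℓ hv, hϖ,
      Units.val_inv_eq_inv_val, map_inv₀, hϖ,
      inv_mul_cancel₀ (WithZero.exp_ne_zero : WithZero.exp (-1 : ℤ) ≠ 0)]
    exact ⟨le_rfl, le_rfl⟩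
  · rw [uniformizerIdele_apply_of_ne _ _ _ hw, uniformizerIdele_apply_of_ne _ _ _ hw,
      valuation_natCast_of_ne hv hw]
    simp

include hℓ hv hr in
/-- For `r = -ℓ`, at a place `w ≠ (ℓ)` with `ℓ + 1 ∈ 𝔭_w^n` both `y_w - 1` and `y_w⁻¹ - 1` have
valuation `≤ exp(-n)`. [folklore] -/
theorem testIdele_close {w : HeightOneSpectrum (𝓞 ℚ)} (hw : w ≠ v) {n : ℕ}
    (h : ((ℓ + 1 : ℕ) : 𝓞 ℚ) ∈ w.asIdeal ^ n) :
    Valued.v ((((Units.map (algebraMap ℚ (FiniteAdeleRing (𝓞 ℚ) ℚ) : ℚ →* FiniteAdeleRing (𝓞 ℚ) ℚ)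
        r)⁻¹ * uniformizerIdele ℚ v ϖ : (FiniteAdeleRing (𝓞 ℚ) ℚ)ˣ) : FiniteAdeleRing (𝓞 ℚ) ℚ) w - 1)
        ≤ WithZero.exp (-(n : ℤ)) ∧
      Valued.v ((((((Units.map (algebraMap ℚ (FiniteAdeleRing (𝓞 ℚ) ℚ) :
        ℚ →* FiniteAdeleRing (𝓞 ℚ) ℚ) r)⁻¹ * uniformizerIdele ℚ v ϖ)⁻¹ : (FiniteAdeleRing (𝓞 ℚ) ℚ)ˣ)) :
          FiniteAdeleRing (𝓞 ℚ) ℚ) w - 1) ≤ WithZero.exp (-(n : ℤ)) := by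
  have hℓ0 : (ℓ : ℚ) ≠ 0 := by exact_mod_cast hℓ.ne_zero
  have hvℓ : w.valuation ℚ (ℓ : ℚ) = 1 := valuation_natCast_of_ne hv hw
  have hsucc : w.valuation ℚ ((ℓ + 1 : ℕ) : ℚ) ≤ WithZero.exp (-(n : ℤ)) :=
    valuation_natCast_le_of_mem_pow h
  rw [testIdele_apply, testIdele_inv_apply, uniformizerIdele_apply_of_ne _ _ _ hw,
    uniformizerIdele_apply_of_ne _ _ _ hw, mul_one, one_mul, algebraMap_apply_sub_one,
    algebraMap_apply_sub_one, valued_algebraMap_apply, valued_algebraMap_apply, hr]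
  constructor
  · have e1 : (-(ℓ : ℚ))⁻¹ - 1 = -(((ℓ + 1 : ℕ) : ℚ) * (ℓ : ℚ)⁻¹) := by
      push_cast
      field_simp
      ring
    rw [e1, Valuation.map_neg, Valuation.map_mul, map_inv₀, hvℓ, inv_one, mul_one]
    exact hsucc
  · have e2 : (-(ℓ : ℚ)) - 1 = -(((ℓ + 1 : ℕ) : ℚ)) := by
      push_cast
      ring
    rw [e2, Valuation.map_neg]
    exact hsucc

end RatPlaces

/-! ## 5. Auxiliary facts for the contradiction -/

/-- The trivial character `1 : Γ_F → GL₁(k)` is unramified at every finite place, with Frobenius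
polynomial `X - 1`. [folklore] -/
theorem trivial_unramified_frobOne (F : Type) [Field F] [NumberField F] (k : Type) [Field k]
    [TopologicalSpace k] (w : HeightOneSpectrum (𝓞 F)) :
    (1 : FramedGaloisRep F k 1).IsUnramifiedAt w ∧
      (1 : FramedGaloisRep F k 1).HasFrobCharpolyAt w (X - C (1 : k)) := by
  refine ⟨fun 𝔓 _ σ _ => rfl, fun 𝔓 _ σ _ => ?_⟩
  show Matrix.charpoly (((1 : FramedGaloisRep F k 1) σ : GL (Fin 1) k) : Matrix (Fin 1) (Fin 1) k) =
    X - C 1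
  simp [Matrix.charpoly_one]

/-- `2 ≠ 0` in a ring of prime characteristic `p ≠ 2`. [folklore] -/
theorem two_ne_zero_of_charP (k : Type) [Field k] (p : ℕ) [Fact p.Prime] [CharP k p] (hp : p ≠ 2) :
    (2 : k) ≠ 0 := by
  intro h
  have h' : ((2 : ℕ) : k) = 0 := by exact_mod_cast h
  rw [CharP.cast_eq_zero_iff k p 2] at h'
  exact hp ((Nat.prime_dvd_prime_iff_eq (Fact.out : p.Prime) Nat.prime_two).1 h')

/-- The `X³`-coefficient of the crux's Hecke polynomial in rank `3`. [folklore] -/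
theorem coeff_three_heckePoly {k : Type} [Field k] (q : ℕ) (b : ℕ → k) :
    (1 + ∑ j ∈ Finset.Icc 1 3, C ((-1 : k) ^ j * (q : k) ^ (j * (j + 1) / 2) * b j) * X ^ j :
      Polynomial k).coeff 3 = -((q : k) ^ 6 * b 3) := by
  rw [Polynomial.coeff_add, Polynomial.coeff_one, Polynomial.finsetSum_coeff,
    Finset.sum_eq_single_of_mem 3 (by simp) fun j _ hj => by
      rw [Polynomial.coeff_C_mul, Polynomial.coeff_X_pow, if_neg (fun h => hj h.symm), mul_zero],
    Polynomial.coeff_C_mul, Polynomial.coeff_X_pow, if_pos rfl, mul_one]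
  norm_num

/-- The `X³`-coefficient of `(1 - X)(1 - X²)` is `1`. [folklore] -/
theorem coeff_three_oneSubX_mul {k : Type} [Field k] :
    ((1 - C (1 : k)⁻¹ * X ^ 1) * (1 - C (1 : k)⁻¹ * X ^ 2) : Polynomial k).coeff 3 = 1 := by
  have : ((1 - C (1 : k)⁻¹ * X ^ 1) * (1 - C (1 : k)⁻¹ * X ^ 2) : Polynomial k) =
      1 - X - X ^ 2 + X ^ 3 := by
    simp only [inv_one, map_one, one_mul, pow_one]
    ring
  rw [this]
  simp [Polynomial.coeff_one, Polynomial.coeff_X_pow, Polynomial.coeff_X]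

/-! ## 6. The theorem: the crux fails for every complex cubic field with a completely split odd prime
whose primes `ℓ ≡ -1 (mod M₀)` split as `𝔭₁ 𝔭₂` with residue degrees `1, 2` -/

open Summit.Langlands.Langlands.Theses.SplitPrimeInduction (MonomialSerreAtSplitPrimes) in
/-- **`MonomialSerreAtSplitPrimes` fails for any cubic field `F` with `r₁(F) ≤ 1`, an odd prime `p`
completely split in `F` (in the crux's own typing: `e = f = 1` at every place over `p`) and a modulus
`M₀ > 0` and bound `B₀` such that every prime `ℓ > B₀`, `ℓ ≡ -1 (mod M₀)`, has EXACTLY two places of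
`F` above the place of `ℚ` containing `ℓ`, of residue degrees `1` and `2` over `𝓞 ℚ`** (true for
`F = ℚ(∛2)`, `p = 31`, `M₀ = 3`: `x³ - 2 ≡ (x-4)(x-7)(x-20) (mod 31)`, and for `ℓ ≡ 2 (mod 3)` cubing
is a bijection of `𝔽_ℓ`, so `x³ - 2 ≡ (x - r)·(irreducible quadratic)`; Dedekind–Kummer).
PROOF.  Apply the crux to the TRIVIAL character `χ = 1` of `Γ_F` (`c ≡ 1`, `Sχ = ∅`; coefficients
`k = 𝔽̄_p` discrete); let `K'` (open) and `e ≠ 0` be the asserted level and eigenclass.  Openness of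
`K'` gives finitely many places `I` and congruence exponents `N_v` such that every scalar idèle `y·1`,
`y, y⁻¹` integral with `y ≡ 1 (mod 𝔭_v^{N_v})` on `I`, lies in `K'`.  Dirichlet gives a prime
`ℓ ≡ -1 (mod p·M₀·∏_{v ∈ I ∪ S'} q_v^{N_v+1})`, so the place `v = (ℓ)` avoids `S' ∪ I`.
(A) CENTRAL SIGN: the top Hecke element `t_{v,3} = ϖ_v·1` is the scalar of the idèle `ϖ_v = (-ℓ)·y`,
`y = (-ℓ)⁻¹ϖ_v` with `y·1 ∈ K'`; so `T^{(3)}_v = T_{(-ℓ)·1} = id` on `H^{i'}(X_{K'}, k)` (a central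
element of `GL₃(ℚ)` acts trivially on group cohomology), whence `b_{v,3} = 1`.
(B) SPLITTING: `(ℓ)` has two places above it with `f = 1, 2`, so the asserted identity reads
`1 - … - ℓ⁶ b_{v,3} X³ = (1 - X)(1 - X²)`, i.e. `-ℓ⁶ b_{v,3} = 1`; with `ℓ ≡ -1 (mod p)` and `b_{v,3} = 1`
this is `-1 = 1` in `k`, contradicting `p ≠ 2`. [folklore] -/
theorem monomialSerreAtSplitPrimes_false_of_cubicField (F : Type) [Field F] [NumberField F]
    (hd3 : Module.finrank ℚ F = 3) (hr1 : InfinitePlace.nrRealPlaces F ≤ 1) {p : ℕ} (hp : p.Prime)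
    (hp2 : p ≠ 2)
    (hsplit : ∀ v : HeightOneSpectrum (𝓞 F), ((p : ℕ) : 𝓞 F) ∈ v.asIdeal →
      v.asIdeal.ramificationIdx ℤ = 1 ∧ v.asIdeal.inertiaDeg ℤ = 1)
    {M₀ B₀ : ℕ} (hM₀ : 0 < M₀)
    (hH : ∀ ℓ : ℕ, ℓ.Prime → B₀ < ℓ → M₀ ∣ ℓ + 1 →
      ∀ v : HeightOneSpectrum (𝓞 ℚ), ((ℓ : ℕ) : 𝓞 ℚ) ∈ v.asIdeal →
        ∃ w₁ w₂ : HeightOneSpectrum (𝓞 F), w₁ ≠ w₂ ∧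
          {w : HeightOneSpectrum (𝓞 F) | w.asIdeal.under (𝓞 ℚ) = v.asIdeal} = {w₁, w₂} ∧
          w₁.asIdeal.inertiaDeg (𝓞 ℚ) = 1 ∧ w₂.asIdeal.inertiaDeg (𝓞 ℚ) = 2) :
    ¬ MonomialSerreAtSplitPrimes := by
  intro hcrux
  haveI : Fact p.Prime := ⟨hp⟩
  -- coefficients `k = 𝔽̄_p`, discrete
  let k : Type := AlgebraicClosure (ZMod p)
  letI : TopologicalSpace k := ⊥
  haveI : DiscreteTopology k := ⟨rfl⟩
  have hχ : ∀ w ∉ (∅ : Finset (HeightOneSpectrum (𝓞 F))), (1 : FramedGaloisRep F k 1).IsUnramifiedAt w ∧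
      (1 : FramedGaloisRep F k 1).HasFrobCharpolyAt w (X - C ((fun _ => (1 : k)) w)) :=
    fun w _ => trivial_unramified_frobOne F k w
  obtain ⟨S', K', ϖ', i', b, hϖ', hK'o, -, -, ⟨e, he0, heig⟩, hpoly⟩ :=
    hcrux F (by omega) hr1 p hp2 hsplit k (1 : FramedGaloisRep F k 1) ∅ (fun _ => 1) hχ
  -- the neighbourhood of `1` inside `K'`
  obtain ⟨I, hI, γ, hγ0, hK'nbhd⟩ := exists_forall_scalar_mem ℚ hK'o K'.one_mem
  -- congruence exponents
  let N : HeightOneSpectrum (𝓞 ℚ) → ℕ := fun v => (1 - WithZero.log (γ v)).toNat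
  have hN : ∀ v, WithZero.exp (-(N v : ℤ)) < γ v := by
    intro v
    rw [← WithZero.lt_log_iff_exp_lt (hγ0 v)]
    have := Int.self_le_toNat (1 - WithZero.log (γ v))
    simp only [N]
    omega
  -- the modulus and the Dirichlet prime
  let T : Finset (HeightOneSpectrum (𝓞 ℚ)) := hI.toFinset ∪ S'
  let Mod : ℕ := p * M₀ * ∏ v ∈ T, v.residueCard ^ (N v + 1)
  have hMod0 : Mod ≠ 0 := by
    refine mul_ne_zero (mul_ne_zero hp.ne_zero hM₀.ne') (Finset.prod_ne_zero_iff.2 fun v _ => ?_)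
    exact pow_ne_zero _ (by have := v.one_lt_residueCard; omega)
  haveI : NeZero Mod := ⟨hMod0⟩
  obtain ⟨ℓ, hℓB, hℓ, hℓmod⟩ :=
    Nat.forall_exists_prime_gt_and_eq_mod (isUnit_one.neg : IsUnit (-1 : ZMod Mod)) B₀
  have hdvd : Mod ∣ ℓ + 1 := by
    rw [← ZMod.natCast_eq_zero_iff]
    push_cast
    rw [hℓmod, neg_add_cancel]
  have hM₀dvd : M₀ ∣ ℓ + 1 := (Dvd.intro_left _ rfl : M₀ ∣ p * M₀).trans ((Dvd.intro _ rfl).trans hdvd)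
  have hpdvd : p ∣ ℓ + 1 := (Dvd.intro _ rfl : p ∣ p * M₀).trans ((Dvd.intro _ rfl).trans hdvd)
  have hTdvd : ∀ v ∈ T, v.residueCard ^ (N v + 1) ∣ ℓ + 1 := fun v hv =>
    ((Finset.dvd_prod_of_mem _ hv).trans (Dvd.intro_left _ rfl)).trans hdvd
  -- the place `v = (ℓ)`; it avoids `S'` and `I`
  let v : HeightOneSpectrum (𝓞 ℚ) := HeightOneSpectrum.ofPrime (prime_span_natCast hℓ)
  have hv : v.asIdeal = Ideal.span {(ℓ : 𝓞 ℚ)} := rfl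
  have hvT : v ∉ T := by
    intro hvT
    have h1 : ℓ ∣ ℓ + 1 := by
      have := hTdvd v hvT
      rw [residueCard_eq_of_asIdeal_eq hv, pow_succ] at this
      exact (Dvd.intro_left _ rfl).trans this
    exact hℓ.ne_one (Nat.dvd_one.1 ((Nat.dvd_add_right (dvd_refl ℓ)).1 h1))
  have hvS' : v ∉ S' := fun h => hvT (Finset.mem_union_right _ h)
  have hvI : v ∉ I := fun h => hvT (Finset.mem_union_left _ (hI.mem_toFinset.2 h))
  -- the rational unit `r = -ℓ` and the test idèle `y = r⁻¹ ϖ'_v`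
  let r : ℚˣ := Units.mk0 (-(ℓ : ℚ)) (neg_ne_zero.2 (by exact_mod_cast hℓ.ne_zero))
  have hr : (r : ℚ) = -(ℓ : ℚ) := rfl
  -- (A) the top Hecke operator at `v` is the identity, so `b v 3 = 1`
  have hyK : Matrix.GeneralLinearGroup.scalar (Fin (Module.finrank ℚ F))
      ((Units.map (algebraMap ℚ (FiniteAdeleRing (𝓞 ℚ) ℚ) : ℚ →* FiniteAdeleRing (𝓞 ℚ) ℚ) r)⁻¹ *
        uniformizerIdele ℚ v (ϖ' v)) ∈ K' := by
    refine hK'nbhd _ (testIdele_integral hℓ hv (ϖ' v) hr (hϖ' v)) fun w hw => ?_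
    have hwv : w ≠ v := fun h => hvI (h ▸ hw)
    have hwT : w ∈ T := Finset.mem_union_left _ (hI.mem_toFinset.2 hw)
    have hmem : ((ℓ + 1 : ℕ) : 𝓞 ℚ) ∈ w.asIdeal ^ (N w + 1) := by
      obtain ⟨c, hc⟩ := hTdvd w hwT
      rw [hc, Nat.cast_mul, Nat.cast_pow]
      exact Ideal.mul_mem_right _ _ (Ideal.pow_mem_pow (Ideal.absNorm_mem w.asIdeal) _)
    obtain ⟨h₁, h₂⟩ := testIdele_close hℓ hv (ϖ' v) hr hwv hmem
    have hlt : WithZero.exp (-((N w + 1 : ℕ) : ℤ)) < γ w :=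
      lt_of_le_of_lt (WithZero.exp_le_exp.2 (by push_cast; omega)) (hN w)
    exact ⟨h₁.trans_lt hlt, h₂.trans_lt hlt⟩
  have hT3 : ArithmeticQuotient.heckeEnd k K' (GLn.sndHom (Module.finrank ℚ F) ℚ
      (heckeDiagAt (Module.finrank ℚ F) ℚ v (ϖ' v) (Module.finrank ℚ F))) k
      (Matrix.GeneralLinearGroup.map (algebraMap ℚ (FiniteAdeleRing (𝓞 ℚ) ℚ))) i' e = e := by
    have hcoset : ((GLn.sndHom (Module.finrank ℚ F) ℚ
        (heckeDiagAt (Module.finrank ℚ F) ℚ v (ϖ' v) (Module.finrank ℚ F)) :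
        GL (Fin (Module.finrank ℚ F)) (FiniteAdeleRing (𝓞 ℚ) ℚ)) :
          GL (Fin (Module.finrank ℚ F)) (FiniteAdeleRing (𝓞 ℚ) ℚ) ⧸ K') =
        ((Matrix.GeneralLinearGroup.map (algebraMap ℚ (FiniteAdeleRing (𝓞 ℚ) ℚ))
          (Matrix.GeneralLinearGroup.scalar (Fin (Module.finrank ℚ F)) r) :
            GL (Fin (Module.finrank ℚ F)) (FiniteAdeleRing (𝓞 ℚ) ℚ)) :
            GL (Fin (Module.finrank ℚ F)) (FiniteAdeleRing (𝓞 ℚ) ℚ) ⧸ K') := by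
      rw [sndHom_heckeDiagAt_self, uniformizerIdele_eq_mul r (ϖ' v), map_mul,
        Matrix.GeneralLinearGroup.map_scalar]
      exact QuotientGroup.mk_mul_of_mem _ hyK
    rw [heckeEnd_eq_of_coe_eq (Matrix.GeneralLinearGroup.map (algebraMap ℚ (FiniteAdeleRing (𝓞 ℚ) ℚ)))
      K' hcoset i']
    exact heckeEnd_principalScalar_apply (Module.finrank ℚ F) ℚ k K' k r i' e
  have hb3 : b v (Module.finrank ℚ F) = 1 := by
    have h := heig v hvS' (Module.finrank ℚ F) (by omega) le_rfl
    rw [hT3] at h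
    by_contra hb
    apply he0
    have h' : (b v (Module.finrank ℚ F) - 1) • e = 0 := by rw [sub_smul, one_smul, ← h, sub_self]
    rcases smul_eq_zero.1 h' with h'' | h''
    · exact absurd (sub_eq_zero.1 h'') hb
    · exact h''
  -- (B) the polynomial identity at `v`: two places above `(ℓ)` of degrees `1` and `2`
  obtain ⟨w₁, w₂, hne, hset, hf₁, hf₂⟩ := hH ℓ hℓ hℓB hM₀dvd v (natCast_mem_of_asIdeal_eq hv)
  have hP := (hpoly v hvS').2
  rw [hset, finprod_mem_pair hne, hf₁, hf₂] at hP
  have h3 := congrArg (fun P : Polynomial k => P.coeff 3) hP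
  rw [coeff_three_oneSubX_mul, hd3, coeff_three_heckePoly, ← hd3, hb3, mul_one,
    residueCard_eq_of_asIdeal_eq hv] at h3
  -- `ℓ ≡ -1 (mod p)` in `k`
  have hℓk : (ℓ : k) = -1 := by
    have h0 : ((ℓ + 1 : ℕ) : k) = 0 := (CharP.cast_eq_zero_iff k p _).2 hpdvd
    push_cast at h0
    exact eq_neg_of_add_eq_zero_left h0
  rw [hℓk] at h3
  -- `-1 = 1` in `k`: contradiction with `p ≠ 2`
  apply two_ne_zero_of_charP k p hp2
  linear_combination -h3


end Summit.Langlands.Langlands.Cruxes.MonomialSerreAtSplitPrimes.Disproof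

namespace Summit.Langlands.Langlands.Cruxes.MonomialSerreAtSplitPrimes.Disproof

open Ideal
open Literature.NumberTheory.NumberFields Literature.NumberTheory.NumberFields.MonicCubic
  Literature.NumberTheory.NumberFields.PureCubic

/-! ## 7. Dedekind–Kummer data for a pure cubic field `K ∋ θ`, `θ³ = m` -/

section PureCubicGeneral

variable {K : Type} [Field K] [NumberField K] {m : ℕ} {θ : 𝓞 K}

/-- `minpoly_ℤ θ (mod p) = X³ - m` for `θ³ = m` not a cube. [folklore] -/
theorem map_minpoly_eq (hm : ∀ r : ℕ, r ^ 3 ≠ m) (hθ : θ ^ 3 = (m : 𝓞 K)) (p : ℕ) :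
    (minpoly ℤ θ).map (Int.castRingHom (ZMod p)) = X ^ 3 - C (m : ZMod p) := by
  have hmin : minpoly ℤ θ = poly 0 0 (-(m : ℤ)) := by
    rw [← thetaInt_eq hθ]; exact minpoly_thetaInt (irreducible_polyQ hm) (aeval_poly hθ)
  rw [hmin, poly]
  simp [Polynomial.map_pow, sub_eq_add_neg]

/-- **Dedekind–Kummer for `ℚ(∛m)` at `p ∤ 3m`**: a prime `P` of `𝓞 K` over `p` corresponds to a monic
irreducible factor `Q` of `X³ - m (mod p)`, with residue degree `deg Q` and ramification index the
multiplicity of `Q` (Mathlib `NumberField.Ideal.primesOverSpanEquivMonicFactorsMod`).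
[cite: Cohen1993, §4.8.2 Thm. 4.8.13 and §6.4] -/
theorem exists_factor_of_mem_primesOver (h3 : Module.finrank ℚ K = 3) (hm : ∀ r : ℕ, r ^ 3 ≠ m)
    (hθ : θ ^ 3 = (m : 𝓞 K)) {p : ℕ} (hp : p.Prime) (hpm : ¬ p ∣ 3 * m) {P : Ideal (𝓞 K)}
    (hP : P ∈ primesOver (span {(p : ℤ)}) (𝓞 K)) :
    ∃ Q : (ZMod p)[X], Irreducible Q ∧ Q.Monic ∧ Q ∣ X ^ 3 - C (m : ZMod p) ∧
      P.inertiaDeg ℤ = Q.natDegree ∧ P.ramificationIdx ℤ = multiplicity Q (X ^ 3 - C (m : ZMod p)) := by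
  classical
  haveI := Fact.mk hp
  have hexp : ¬ p ∣ RingOfIntegers.exponent θ := not_dvd_exponent h3 hm hθ hp hpm
  set e := NumberField.Ideal.primesOverSpanEquivMonicFactorsMod (K := K) hexp
  set Q := e ⟨P, hP⟩ with hQ
  have hmem : (Q : (ZMod p)[X]) ∈ RingOfIntegers.monicFactorsMod θ p := Q.2
  have hmem' := hmem
  simp only [RingOfIntegers.monicFactorsMod, Multiset.mem_toFinset, map_minpoly_eq hm hθ] at hmem'
  have h0 : (X ^ 3 - C (m : ZMod p) : (ZMod p)[X]) ≠ 0 := (monic_X_pow_sub_C _ three_ne_zero).ne_zero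
  obtain ⟨hirr, hmon, hdvd⟩ := (Polynomial.mem_normalizedFactors_iff h0).mp hmem'
  refine ⟨Q, hirr, hmon, hdvd, ?_, ?_⟩
  · have := NumberField.Ideal.inertiaDeg_primesOverSpanEquivMonicFactorsMod_symm_apply' hexp hmem
    rwa [show (⟨(Q : (ZMod p)[X]), hmem⟩ : RingOfIntegers.monicFactorsMod θ p) = Q from Subtype.ext rfl,
      Equiv.symm_apply_apply] at this
  · have := NumberField.Ideal.ramificationIdx_primesOverSpanEquivMonicFactorsMod_symm_apply' hexp hmem
    rwa [show (⟨(Q : (ZMod p)[X]), hmem⟩ : RingOfIntegers.monicFactorsMod θ p) = Q from Subtype.ext rfl,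
      Equiv.symm_apply_apply, map_minpoly_eq hm hθ] at this

/-- **The primes over `p ∤ 3m` from a factorisation `X³ - m ≡ Q₁ · Q₂ (mod p)` into two DISTINCT monic
irreducibles**: there are exactly two primes of `𝓞 K` over `p`, of residue degrees `deg Q₁`, `deg Q₂`.
[cite: Cohen1993, §4.8.2 Thm. 4.8.13] -/
theorem primesOver_of_two_factors (h3 : Module.finrank ℚ K = 3) (hm : ∀ r : ℕ, r ^ 3 ≠ m)
    (hθ : θ ^ 3 = (m : 𝓞 K)) {p : ℕ} (hp : p.Prime) (hpm : ¬ p ∣ 3 * m) {Q₁ Q₂ : (ZMod p)[X]}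
    (h₁ : Irreducible Q₁) (h₁m : Q₁.Monic) (h₂ : Irreducible Q₂) (h₂m : Q₂.Monic) (hne : Q₁ ≠ Q₂)
    (hfac : (X ^ 3 - C (m : ZMod p) : (ZMod p)[X]) = Q₁ * Q₂) :
    ∃ P₁ P₂ : Ideal (𝓞 K), P₁ ≠ P₂ ∧ primesOver (span {(p : ℤ)}) (𝓞 K) = {P₁, P₂} ∧
      P₁.inertiaDeg ℤ = Q₁.natDegree ∧ P₂.inertiaDeg ℤ = Q₂.natDegree := by
  classical
  haveI := Fact.mk hp
  have hexp : ¬ p ∣ RingOfIntegers.exponent θ := not_dvd_exponent h3 hm hθ hp hpm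
  set e := NumberField.Ideal.primesOverSpanEquivMonicFactorsMod (K := K) hexp
  have h0 : (X ^ 3 - C (m : ZMod p) : (ZMod p)[X]) ≠ 0 := (monic_X_pow_sub_C _ three_ne_zero).ne_zero
  have hmem₁ : Q₁ ∈ RingOfIntegers.monicFactorsMod θ p := by
    simp only [RingOfIntegers.monicFactorsMod, Multiset.mem_toFinset, map_minpoly_eq hm hθ]
    exact (Polynomial.mem_normalizedFactors_iff h0).mpr ⟨h₁, h₁m, hfac ▸ dvd_mul_right _ _⟩
  have hmem₂ : Q₂ ∈ RingOfIntegers.monicFactorsMod θ p := by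
    simp only [RingOfIntegers.monicFactorsMod, Multiset.mem_toFinset, map_minpoly_eq hm hθ]
    exact (Polynomial.mem_normalizedFactors_iff h0).mpr ⟨h₂, h₂m, hfac ▸ dvd_mul_left _ _⟩
  refine ⟨e.symm ⟨Q₁, hmem₁⟩, e.symm ⟨Q₂, hmem₂⟩, ?_, ?_, ?_, ?_⟩
  · intro h
    have := e.symm.injective (Subtype.ext h)
    exact hne (congrArg Subtype.val this)
  · ext P
    simp only [Set.mem_insert_iff, Set.mem_singleton_iff]
    constructor
    · intro hP
      -- the factor attached to `P` divides `Q₁ Q₂`, hence is one of them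
      set Q := e ⟨P, hP⟩ with hQ
      have hmem : (Q : (ZMod p)[X]) ∈ RingOfIntegers.monicFactorsMod θ p := Q.2
      have hmem' := hmem
      simp only [RingOfIntegers.monicFactorsMod, Multiset.mem_toFinset, map_minpoly_eq hm hθ] at hmem'
      obtain ⟨hirr, hmon, hdvd⟩ := (Polynomial.mem_normalizedFactors_iff h0).mp hmem'
      rw [hfac] at hdvd
      have hP' : P = ((e.symm Q : primesOver (span {(p : ℤ)}) (𝓞 K)) : Ideal (𝓞 K)) := by
        rw [hQ, Equiv.symm_apply_apply]
      rcases hirr.prime.dvd_or_dvd hdvd with hd | hd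
      · left
        have hQ₁ : (Q : (ZMod p)[X]) = Q₁ := eq_of_monic_of_associated hmon h₁m (hirr.associated_of_dvd h₁ hd)
        rw [hP']
        congr 1
        exact congrArg e.symm (Subtype.ext hQ₁)
      · right
        have hQ₂ : (Q : (ZMod p)[X]) = Q₂ := eq_of_monic_of_associated hmon h₂m (hirr.associated_of_dvd h₂ hd)
        rw [hP']
        congr 1
        exact congrArg e.symm (Subtype.ext hQ₂)
    · rintro (rfl | rfl)
      · exact (e.symm ⟨Q₁, hmem₁⟩).2
      · exact (e.symm ⟨Q₂, hmem₂⟩).2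
  · exact NumberField.Ideal.inertiaDeg_primesOverSpanEquivMonicFactorsMod_symm_apply' hexp hmem₁
  · exact NumberField.Ideal.inertiaDeg_primesOverSpanEquivMonicFactorsMod_symm_apply' hexp hmem₂

end PureCubicGeneral

/-! ## 8. `X³ - 2` modulo a prime `ℓ ≡ 2 (mod 3)`: a linear times an irreducible quadratic factor -/

section CubeMap

variable {ℓ : ℕ} [hℓ : Fact ℓ.Prime]

/-- For `ℓ ≡ 2 (mod 3)` cubing is injective on `𝔽_ℓ` (`x = (x³)^{-t}` with `ℓ - 1 = 3t + 1`).
[folklore] -/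
theorem cube_injective (h3 : ℓ % 3 = 2) : Function.Injective fun x : ZMod ℓ => x ^ 3 := by
  intro x y hxy
  simp only at hxy
  -- `ℓ - 1 = 3 t + 1`
  obtain ⟨t, ht⟩ : ∃ t, ℓ - 1 = 3 * t + 1 := ⟨ℓ / 3, by have := Nat.div_add_mod ℓ 3; omega⟩
  have key : ∀ z : ZMod ℓ, z ≠ 0 → z = ((z ^ 3) ^ t)⁻¹ := by
    intro z hz
    have h1 : z ^ (ℓ - 1) = 1 := ZMod.pow_card_sub_one_eq_one hz
    rw [ht, pow_succ, pow_mul] at h1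
    exact (eq_inv_of_mul_eq_one_right h1)
  by_cases hx : x = 0
  · subst hx
    simp only [ne_eq, OfNat.ofNat_ne_zero, not_false_eq_true, zero_pow] at hxy
    exact (pow_eq_zero_iff three_ne_zero).1 hxy.symm |>.symm
  by_cases hy : y = 0
  · subst hy
    simp only [ne_eq, OfNat.ofNat_ne_zero, not_false_eq_true, zero_pow] at hxy
    exact (pow_eq_zero_iff three_ne_zero).1 hxy
  rw [key x hx, key y hy, hxy]

/-- Hence for `ℓ ≡ 2 (mod 3)` every element of `𝔽_ℓ` is a cube. [folklore] -/
theorem cube_surjective (h3 : ℓ % 3 = 2) : Function.Surjective fun x : ZMod ℓ => x ^ 3 :=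
  Finite.surjective_of_injective (cube_injective h3)

/-- **`X³ - c = (X - r)(X² + rX + r²)` with the quadratic IRREDUCIBLE** over `𝔽_ℓ`, `ℓ ≡ 2 (mod 3)`,
`ℓ ≠ 2`, `r³ = c ≠ 0`: a root `s` of the quadratic has `s³ = c = r³`, so `s = r` and `3r² = 0`.
[folklore] -/
theorem quadratic_irreducible (h3 : ℓ % 3 = 2) {r : ZMod ℓ} (hr : r ≠ 0) :
    Irreducible (X ^ 2 + C r * X + C (r ^ 2) : (ZMod ℓ)[X]) := by
  have hdeg : (X ^ 2 + C r * X + C (r ^ 2) : (ZMod ℓ)[X]).natDegree = 2 := by compute_degree!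
  refine irreducible_of_degree_le_three_of_not_isRoot (by rw [hdeg]; decide) fun s hs => ?_
  rw [IsRoot.def] at hs
  simp only [eval_add, eval_pow, eval_X, eval_mul, eval_C] at hs
  -- `s³ = r³`
  have hs3 : s ^ 3 = r ^ 3 := by linear_combination (s - r) * hs
  have hsr : s = r := cube_injective h3 hs3
  subst hsr
  have h3s : (3 : ZMod ℓ) * s ^ 2 = 0 := by linear_combination hs
  have h3ne : (3 : ZMod ℓ) ≠ 0 := by
    intro h
    have : ((3 : ℕ) : ZMod ℓ) = 0 := by exact_mod_cast h
    rw [ZMod.natCast_eq_zero_iff] at this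
    have := (Nat.prime_dvd_prime_iff_eq hℓ.out Nat.prime_three).1 this
    omega
  exact hr (pow_eq_zero_iff two_ne_zero |>.1 ((mul_eq_zero.1 h3s).resolve_left h3ne))

/-- The factorisation `X³ - r³ = (X - r)(X² + rX + r²)`. [folklore] -/
theorem X_pow_three_sub_eq_mul (r : ZMod ℓ) :
    (X ^ 3 - C (r ^ 3) : (ZMod ℓ)[X]) = (X - C r) * (X ^ 2 + C r * X + C (r ^ 2)) := by
  simp only [map_pow]
  ring

/-- The two factors are distinct (degrees `1 ≠ 2`). [folklore] -/
theorem X_sub_C_ne_quadratic (r : ZMod ℓ) :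
    (X - C r : (ZMod ℓ)[X]) ≠ X ^ 2 + C r * X + C (r ^ 2) := by
  intro h
  have h1 : (X - C r : (ZMod ℓ)[X]).natDegree = 1 := natDegree_X_sub_C r
  have h2 : (X ^ 2 + C r * X + C (r ^ 2) : (ZMod ℓ)[X]).natDegree = 2 := by compute_degree!
  rw [h, h2] at h1
  exact absurd h1 (by decide)

end CubeMap

/-! ## 9. From primes over `(ℓ) ⊂ ℤ` to places over the place `(ℓ)` of `ℚ` -/

section Bridge

variable {K : Type} [Field K] [NumberField K]

omit [NumberField K] in
/-- A prime of `ℤ` below an ideal containing the rational prime `ℓ` is `(ℓ)`. [folklore] -/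
theorem int_under_eq_span {I : Ideal (𝓞 K)} [I.IsPrime] {ℓ : ℕ} (hℓ : ℓ.Prime)
    (h : (ℓ : 𝓞 K) ∈ I) : I.under ℤ = span {(ℓ : ℤ)} := by
  have hp0 : (span {(ℓ : ℤ)}) ≠ ⊥ := by simp [hℓ.ne_zero]
  have hmax : (span {(ℓ : ℤ)}).IsMaximal :=
    ((span_singleton_prime (by exact_mod_cast hℓ.ne_zero)).mpr
      (Nat.prime_iff_prime_int.mp hℓ)).isMaximal hp0
  refine (hmax.eq_of_le (Ideal.IsPrime.under ℤ I).ne_top ?_).symm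
  rw [span_singleton_le_iff_mem, Ideal.mem_comap, map_natCast]
  exact h

/-- `(ℓ) ⊂ 𝓞 ℚ` is maximal (its norm `ℓ` is prime). [folklore] -/
theorem ratInt_span_isMaximal {ℓ : ℕ} (hℓ : ℓ.Prime) : (span {(ℓ : 𝓞 ℚ)}).IsMaximal := by
  have habs : Ideal.absNorm (span {(ℓ : 𝓞 ℚ)}) = ℓ := by
    rw [Ideal.absNorm_span_singleton, show ((ℓ : ℕ) : 𝓞 ℚ) = algebraMap ℤ (𝓞 ℚ) (ℓ : ℤ) by simp,
      Algebra.norm_algebraMap, RingOfIntegers.rank, Module.finrank_self, pow_one, Int.natAbs_natCast]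
  have hpr : (span {(ℓ : 𝓞 ℚ)}).IsPrime :=
    Ideal.isPrime_of_irreducible_absNorm (by rw [habs]; exact hℓ)
  exact hpr.isMaximal (by rw [Ne, Ideal.span_singleton_eq_bot]; exact_mod_cast hℓ.ne_zero)

/-- A prime of `𝓞 ℚ` containing `ℓ` is `(ℓ)`. [folklore] -/
theorem ratInt_eq_span_of_mem {ℓ : ℕ} (hℓ : ℓ.Prime) {Q : Ideal (𝓞 ℚ)} [hQ : Q.IsPrime]
    (h : (ℓ : 𝓞 ℚ) ∈ Q) : Q = span {(ℓ : 𝓞 ℚ)} :=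
  ((ratInt_span_isMaximal hℓ).eq_of_le hQ.ne_top ((span_singleton_le_iff_mem _).2 h)).symm

/-- The residue degree over `ℤ` of the place of `ℚ` containing `ℓ` is `1` (`N(ℓ) = ℓ`). [folklore] -/
theorem ratInt_inertiaDeg_eq_one {ℓ : ℕ} (hℓ : ℓ.Prime) (v : HeightOneSpectrum (𝓞 ℚ))
    (hv : (ℓ : 𝓞 ℚ) ∈ v.asIdeal) : v.asIdeal.inertiaDeg ℤ = 1 := by
  haveI : v.asIdeal.LiesOver (span {(ℓ : ℤ)}) := ⟨(int_under_eq_span hℓ hv).symm⟩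
  have h := Ideal.pow_inertiaDeg ℓ v.asIdeal
  have habs : Ideal.absNorm v.asIdeal = ℓ := by
    rw [ratInt_eq_span_of_mem hℓ hv, Ideal.absNorm_span_singleton,
      show ((ℓ : ℕ) : 𝓞 ℚ) = algebraMap ℤ (𝓞 ℚ) (ℓ : ℤ) by simp, Algebra.norm_algebraMap,
      RingOfIntegers.rank, Module.finrank_self, pow_one, Int.natAbs_natCast]
  rw [habs] at h
  exact Nat.pow_right_injective hℓ.two_le (h.trans (pow_one ℓ).symm)

omit [NumberField K] in
/-- A prime `P` of `𝓞 K` over `(ℓ) ⊂ ℤ` contains `ℓ`, hence is nonzero. [folklore] -/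
theorem natCast_mem_of_mem_primesOver {ℓ : ℕ} {P : Ideal (𝓞 K)}
    (hP : P ∈ primesOver (span {(ℓ : ℤ)}) (𝓞 K)) : (ℓ : 𝓞 K) ∈ P := by
  have h : (ℓ : ℤ) ∈ P.under ℤ := by
    rw [← hP.2.over]; exact mem_span_singleton_self _
  rw [Ideal.mem_comap, map_natCast] at h
  exact h

/-- **Bridge.**  If the primes of `𝓞 K` over `(ℓ) ⊂ ℤ` are exactly `P₁ ≠ P₂`, then over the place of
`ℚ` containing `ℓ` there are exactly the two places `P₁, P₂`, with residue degrees over `𝓞 ℚ` equal to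
those over `ℤ` (the residue degree of `(ℓ) ⊂ 𝓞 ℚ` over `ℤ` being `1`). [folklore] -/
theorem places_over_of_primesOver {ℓ : ℕ} (hℓ : ℓ.Prime) {P₁ P₂ : Ideal (𝓞 K)} (hne : P₁ ≠ P₂)
    (hprimes : primesOver (span {(ℓ : ℤ)}) (𝓞 K) = {P₁, P₂})
    (v : HeightOneSpectrum (𝓞 ℚ)) (hv : (ℓ : 𝓞 ℚ) ∈ v.asIdeal) :
    ∃ w₁ w₂ : HeightOneSpectrum (𝓞 K), w₁ ≠ w₂ ∧
      {w : HeightOneSpectrum (𝓞 K) | w.asIdeal.under (𝓞 ℚ) = v.asIdeal} = {w₁, w₂} ∧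
      w₁.asIdeal.inertiaDeg (𝓞 ℚ) = P₁.inertiaDeg ℤ ∧ w₂.asIdeal.inertiaDeg (𝓞 ℚ) = P₂.inertiaDeg ℤ := by
  have hP₁ : P₁ ∈ primesOver (span {(ℓ : ℤ)}) (𝓞 K) := by rw [hprimes]; exact Set.mem_insert _ _
  have hP₂ : P₂ ∈ primesOver (span {(ℓ : ℤ)}) (𝓞 K) := by
    rw [hprimes]; exact Set.mem_insert_of_mem _ rfl
  have hℓ0 : (ℓ : 𝓞 K) ≠ 0 := by exact_mod_cast hℓ.ne_zero
  -- under `𝓞 ℚ`, every prime over `(ℓ)` lies over `v`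
  have hunder : ∀ {P : Ideal (𝓞 K)}, P ∈ primesOver (span {(ℓ : ℤ)}) (𝓞 K) →
      P.under (𝓞 ℚ) = v.asIdeal := by
    intro P hP
    haveI := hP.1
    have hmem : (ℓ : 𝓞 ℚ) ∈ P.under (𝓞 ℚ) := by
      rw [Ideal.mem_comap, map_natCast]; exact natCast_mem_of_mem_primesOver hP
    rw [ratInt_eq_span_of_mem hℓ hmem, ratInt_eq_span_of_mem hℓ hv]
  let w₁ : HeightOneSpectrum (𝓞 K) :=
    ⟨P₁, hP₁.1, fun h => hℓ0 (by simpa [h] using natCast_mem_of_mem_primesOver hP₁)⟩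
  let w₂ : HeightOneSpectrum (𝓞 K) :=
    ⟨P₂, hP₂.1, fun h => hℓ0 (by simpa [h] using natCast_mem_of_mem_primesOver hP₂)⟩
  refine ⟨w₁, w₂, fun h => hne (congrArg HeightOneSpectrum.asIdeal h), ?_, ?_, ?_⟩
  · ext w
    simp only [Set.mem_setOf_eq, Set.mem_insert_iff, Set.mem_singleton_iff]
    constructor
    · intro hw
      have hmemK : (ℓ : 𝓞 K) ∈ w.asIdeal := by
        have : (ℓ : 𝓞 ℚ) ∈ w.asIdeal.under (𝓞 ℚ) := hw ▸ hv
        rw [Ideal.mem_comap, map_natCast] at this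
        exact this
      have hwP : w.asIdeal ∈ primesOver (span {(ℓ : ℤ)}) (𝓞 K) :=
        ⟨w.isPrime, ⟨(int_under_eq_span hℓ hmemK).symm⟩⟩
      rw [hprimes] at hwP
      rcases hwP with h | h
      · exact Or.inl (HeightOneSpectrum.ext h)
      · exact Or.inr (HeightOneSpectrum.ext h)
    · rintro (rfl | rfl)
      · exact hunder hP₁
      · exact hunder hP₂
  · haveI := hP₁.1
    haveI : P₁.LiesOver v.asIdeal := ⟨(hunder hP₁).symm⟩
    have ht := Ideal.inertiaDeg_tower (R := ℤ) v.asIdeal P₁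
    rw [ratInt_inertiaDeg_eq_one hℓ v hv, one_mul] at ht
    exact ht.symm
  · haveI := hP₂.1
    haveI : P₂.LiesOver v.asIdeal := ⟨(hunder hP₂).symm⟩
    have ht := Ideal.inertiaDeg_tower (R := ℤ) v.asIdeal P₂
    rw [ratInt_inertiaDeg_eq_one hℓ v hv, one_mul] at ht
    exact ht.symm

end Bridge

/-! ## 10. Splitting in a pure cubic field: `ℓ ≡ 2 (mod 3)` and complete splitting of `31` in `ℚ(∛2)` -/

section Splitting

variable {K : Type} [Field K] [NumberField K] {m : ℕ} {θ : 𝓞 K}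

/-- **In `ℚ(∛m)` a prime `ℓ ≡ 2 (mod 3)`, `ℓ ∤ 3m`, has exactly two primes above it, of residue degrees
`1` and `2`** (`X³ - m ≡ (X - r)(X² + rX + r²)`, the quadratic irreducible). [cite: Cohen1993, §6.4] -/
theorem primesOver_of_mod_three_eq_two (h3K : Module.finrank ℚ K = 3) (hm : ∀ r : ℕ, r ^ 3 ≠ m)
    (hθ : θ ^ 3 = (m : 𝓞 K)) {ℓ : ℕ} (hℓ : ℓ.Prime) (hℓ3 : ℓ % 3 = 2) (hℓm : ¬ ℓ ∣ 3 * m) :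
    ∃ P₁ P₂ : Ideal (𝓞 K), P₁ ≠ P₂ ∧ primesOver (span {(ℓ : ℤ)}) (𝓞 K) = {P₁, P₂} ∧
      P₁.inertiaDeg ℤ = 1 ∧ P₂.inertiaDeg ℤ = 2 := by
  haveI := Fact.mk hℓ
  obtain ⟨r, hr⟩ := cube_surjective hℓ3 (m : ZMod ℓ)
  have hr' : r ^ 3 = (m : ZMod ℓ) := hr
  have hmℓ : (m : ZMod ℓ) ≠ 0 := by
    rw [Ne, ZMod.natCast_eq_zero_iff]
    exact fun h => hℓm (h.mul_left 3)
  have hr0 : r ≠ 0 := by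
    rintro rfl
    apply hmℓ
    rw [← hr']
    simp
  have hfac : (X ^ 3 - C (m : ZMod ℓ) : (ZMod ℓ)[X]) = (X - C r) * (X ^ 2 + C r * X + C (r ^ 2)) := by
    rw [← hr']; exact X_pow_three_sub_eq_mul r
  have hmon₂ : (X ^ 2 + C r * X + C (r ^ 2) : (ZMod ℓ)[X]).Monic := by monicity!
  obtain ⟨P₁, P₂, hne, hset, hf₁, hf₂⟩ := primesOver_of_two_factors h3K hm hθ hℓ hℓm
    (irreducible_X_sub_C r) (monic_X_sub_C r) (quadratic_irreducible hℓ3 hr0) hmon₂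
    (X_sub_C_ne_quadratic r) hfac
  refine ⟨P₁, P₂, hne, hset, by rw [hf₁, natDegree_X_sub_C], ?_⟩
  rw [hf₂]
  compute_degree!

/-- `2` is not a cube. [folklore] -/
theorem two_not_cube (r : ℕ) : r ^ 3 ≠ 2 := by
  intro h
  have h1 : r < 2 := by
    by_contra hle
    push Not at hle
    have := Nat.pow_le_pow_left hle 3
    omega
  interval_cases r <;> simp at h

/-- `X³ - 2 ≡ (X - 4)(X - 7)(X - 20) (mod 31)`. [folklore] -/
theorem X_pow_three_sub_two_mod_thirtyone :
    (X ^ 3 - C ((2 : ℕ) : ZMod 31) : (ZMod 31)[X]) = (X - C 4) * (X - C 7) * (X - C 20) := by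
  haveI : Fact (Nat.Prime 31) := ⟨by norm_num⟩
  have h31 : ((31 : ℕ) : (ZMod 31)[X]) = 0 := by
    rw [← map_natCast C, ZMod.natCast_self, map_zero]
  simp only [map_ofNat, Nat.cast_ofNat] at h31 ⊢
  linear_combination (X ^ 2 - 8 * X + 18 : (ZMod 31)[X]) * h31

/-- **`31` splits completely in `ℚ(∛2)`**: `e = f = 1` at every prime above `31`
(`X³ - 2 ≡ (X-4)(X-7)(X-20) (mod 31)`, distinct linear factors). [cite: Cohen1993, §6.4] -/
theorem split_thirtyone (h3K : Module.finrank ℚ K = 3) (hθ : θ ^ 3 = ((2 : ℕ) : 𝓞 K))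
    (v : HeightOneSpectrum (𝓞 K)) (hv : ((31 : ℕ) : 𝓞 K) ∈ v.asIdeal) :
    v.asIdeal.ramificationIdx ℤ = 1 ∧ v.asIdeal.inertiaDeg ℤ = 1 := by
  have h31 : Nat.Prime 31 := by norm_num
  haveI : Fact (Nat.Prime 31) := ⟨h31⟩
  have hP : v.asIdeal ∈ primesOver (span {((31 : ℕ) : ℤ)}) (𝓞 K) :=
    ⟨v.isPrime, ⟨(int_under_eq_span h31 hv).symm⟩⟩
  obtain ⟨Q, hirr, hmon, hdvd, hf, he⟩ :=
    exists_factor_of_mem_primesOver h3K two_not_cube hθ h31 (by norm_num) hP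
  -- `Q` is one of the three linear factors
  have hdvd' := hdvd
  rw [X_pow_three_sub_two_mod_thirtyone] at hdvd'
  have hdeg : Q.natDegree = 1 := by
    have hpos : 0 < Q.natDegree := natDegree_pos_iff_degree_pos.2 (degree_pos_of_irreducible hirr)
    have hle : Q.natDegree ≤ 1 := by
      rcases hirr.prime.dvd_or_dvd hdvd' with h | h
      · rcases hirr.prime.dvd_or_dvd h with h | h
        · exact (natDegree_le_of_dvd h (X_sub_C_ne_zero _)).trans (natDegree_X_sub_C _).le
        · exact (natDegree_le_of_dvd h (X_sub_C_ne_zero _)).trans (natDegree_X_sub_C _).le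
      · exact (natDegree_le_of_dvd h (X_sub_C_ne_zero _)).trans (natDegree_X_sub_C _).le
    omega
  -- multiplicity `1`: the cubic is separable
  have hsep : (X ^ 3 - C ((2 : ℕ) : ZMod 31) : (ZMod 31)[X]).Separable :=
    separable_X_pow_sub_C _ (by rw [Ne, ZMod.natCast_eq_zero_iff]; norm_num)
      (by rw [Ne, ZMod.natCast_eq_zero_iff]; norm_num)
  have hmult : multiplicity Q (X ^ 3 - C ((2 : ℕ) : ZMod 31) : (ZMod 31)[X]) = 1 := by
    apply multiplicity_eq_of_emultiplicity_eq_some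
    rw [Nat.cast_one]
    exact le_antisymm (emultiplicity_le_one_of_separable hirr.not_isUnit hsep)
      (Order.one_le_iff_pos.2 (emultiplicity_pos_of_dvd hdvd))
  exact ⟨he.trans hmult, hf.trans hdeg⟩

end Splitting

/-! ## 11. The field `ℚ(∛2) = ℚ[X]/(X³ - 2)`: degree `3`, one real place -/

section CubicTwo

/-- `X³ - 2 ∈ ℚ[X]` is irreducible (`2` is not a cube). [folklore] -/
theorem irreducible_X_pow_three_sub_two : Irreducible (X ^ 3 - C (2 : ℚ) : ℚ[X]) := by
  have := irreducible_polyQ (m := 2) two_not_cube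
  rw [polyQ_eq_X_pow_sub_C] at this
  exact_mod_cast this

variable [hirr : Fact (Irreducible (X ^ 3 - C (2 : ℚ) : ℚ[X]))]

/-- `[ℚ(∛2) : ℚ] = 3`. [folklore] -/
theorem finrank_cubicTwo : Module.finrank ℚ (AdjoinRoot (X ^ 3 - C (2 : ℚ))) = 3 := by
  rw [(AdjoinRoot.powerBasis hirr.out.ne_zero).finrank, AdjoinRoot.powerBasis_dim,
    natDegree_X_pow_sub_C]

/-- The class of `X` is a cube root of `2`. [folklore] -/
theorem root_pow_three : (AdjoinRoot.root (X ^ 3 - C (2 : ℚ))) ^ 3 = 2 := by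
  have h := AdjoinRoot.eval₂_root (X ^ 3 - C (2 : ℚ))
  rw [eval₂_sub, eval₂_X_pow, eval₂_C, sub_eq_zero] at h
  rw [h]
  exact map_ofNat (AdjoinRoot.of _) 2

/-- An algebraic integer `θ ∈ ℚ(∛2)` with `θ³ = 2`. [folklore] -/
theorem exists_theta : ∃ θ : 𝓞 (AdjoinRoot (X ^ 3 - C (2 : ℚ))),
    θ ^ 3 = ((2 : ℕ) : 𝓞 (AdjoinRoot (X ^ 3 - C (2 : ℚ)))) := by
  obtain ⟨θ, -, hθ⟩ := exists_ringOfIntegers_of_cube_eq (K := AdjoinRoot (X ^ 3 - C (2 : ℚ)))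
    (m := 2) (α := AdjoinRoot.root (X ^ 3 - C (2 : ℚ))) (by rw [root_pow_three]; norm_num)
  exact ⟨θ, hθ⟩

/-- **`ℚ(∛2)` has a unique real embedding** (a ring map to `ℝ` sends `∛2` to the unique real cube root
of `2`, and is determined by it). [folklore] -/
theorem ringHom_real_eq (σ₁ σ₂ : AdjoinRoot (X ^ 3 - C (2 : ℚ)) →+* ℝ) : σ₁ = σ₂ := by
  have hroot : ∀ σ : AdjoinRoot (X ^ 3 - C (2 : ℚ)) →+* ℝ,
      σ (AdjoinRoot.root (X ^ 3 - C (2 : ℚ))) ^ 3 = 2 := fun σ => by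
    rw [← map_pow, root_pow_three, map_ofNat]
  have heq : σ₁ (AdjoinRoot.root (X ^ 3 - C (2 : ℚ))) = σ₂ (AdjoinRoot.root (X ^ 3 - C (2 : ℚ))) :=
    (Odd.strictMono_pow (by decide : Odd 3)).injective ((hroot σ₁).trans (hroot σ₂).symm)
  refine RingHom.ext fun x => ?_
  obtain ⟨g, rfl⟩ := AdjoinRoot.mk_surjective x
  rw [← AdjoinRoot.aeval_eq, aeval_def, Polynomial.hom_eval₂, Polynomial.hom_eval₂, heq]
  congr 1
  exact RingHom.ext_rat _ _

open NumberField.InfinitePlace in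
/-- **`ℚ(∛2)` has at most one real place.** [folklore] -/
theorem nrRealPlaces_cubicTwo_le : nrRealPlaces (AdjoinRoot (X ^ 3 - C (2 : ℚ))) ≤ 1 := by
  classical
  rw [← card_real_embeddings]
  refine Fintype.card_le_one_iff_subsingleton.2 ⟨fun φ ψ => Subtype.ext ?_⟩
  have h := ringHom_real_eq φ.2.embedding ψ.2.embedding
  refine RingHom.ext fun x => ?_
  have hφ := ComplexEmbedding.IsReal.coe_embedding_apply φ.2 x
  have hψ := ComplexEmbedding.IsReal.coe_embedding_apply ψ.2 x
  rw [← hφ, ← hψ, h]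

end CubicTwo

/-! ## 12. The hypotheses of `monomialSerreAtSplitPrimes_false_of_cubicField` hold for `ℚ(∛2)` -/

/-- **Split data for `ℚ(∛2)`**: for every prime `ℓ > 3` with `3 ∣ ℓ + 1` there are exactly two places
of `ℚ(∛2)` above the place of `ℚ` containing `ℓ`, of residue degrees `1` and `2` over `𝓞 ℚ`.
[cite: Cohen1993, §6.4] -/
theorem cubicTwo_splitData [Fact (Irreducible (X ^ 3 - C (2 : ℚ) : ℚ[X]))]
    {θ : 𝓞 (AdjoinRoot (X ^ 3 - C (2 : ℚ)))} (hθ : θ ^ 3 = ((2 : ℕ) : 𝓞 (AdjoinRoot (X ^ 3 - C (2 : ℚ)))))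
    (ℓ : ℕ) (hℓ : ℓ.Prime) (hB : 3 < ℓ) (hdvd : 3 ∣ ℓ + 1)
    (v : HeightOneSpectrum (𝓞 ℚ)) (hv : ((ℓ : ℕ) : 𝓞 ℚ) ∈ v.asIdeal) :
    ∃ w₁ w₂ : HeightOneSpectrum (𝓞 (AdjoinRoot (X ^ 3 - C (2 : ℚ)))), w₁ ≠ w₂ ∧
      {w : HeightOneSpectrum (𝓞 (AdjoinRoot (X ^ 3 - C (2 : ℚ)))) |
        w.asIdeal.under (𝓞 ℚ) = v.asIdeal} = {w₁, w₂} ∧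
      w₁.asIdeal.inertiaDeg (𝓞 ℚ) = 1 ∧ w₂.asIdeal.inertiaDeg (𝓞 ℚ) = 2 := by
  have hℓ3 : ℓ % 3 = 2 := by omega
  have hℓm : ¬ ℓ ∣ 3 * 2 := by
    intro h
    have := Nat.le_of_dvd (by norm_num) h
    interval_cases ℓ <;> omega
  obtain ⟨P₁, P₂, hne, hset, hf₁, hf₂⟩ :=
    primesOver_of_mod_three_eq_two finrank_cubicTwo two_not_cube hθ hℓ hℓ3 hℓm
  obtain ⟨w₁, w₂, hne', hset', hg₁, hg₂⟩ := places_over_of_primesOver hℓ hne hset v hv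
  exact ⟨w₁, w₂, hne', hset', hg₁.trans hf₁, hg₂.trans hf₂⟩




end Summit.Langlands.Langlands.Cruxes.MonomialSerreAtSplitPrimes.Disproof

namespace Summit.Langlands.Langlands.Cruxes.MonomialSerreAtSplitPrimes.Disproof


/-- Refutes `SplitPrimeInduction.MonomialSerreAtSplitPrimes` [refuted-misstated]. -/
theorem monomialSerreAtSplitPrimes_false :
    ¬ Summit.Langlands.Langlands.Theses.SplitPrimeInduction.MonomialSerreAtSplitPrimes := by
  haveI : Fact (Irreducible (X ^ 3 - C (2 : ℚ) : ℚ[X])) := ⟨irreducible_X_pow_three_sub_two⟩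
  obtain ⟨θ, hθ⟩ := exists_theta
  exact monomialSerreAtSplitPrimes_false_of_cubicField (AdjoinRoot (X ^ 3 - C (2 : ℚ)))
    finrank_cubicTwo nrRealPlaces_cubicTwo_le (p := 31) (by norm_num) (by norm_num)
    (split_thirtyone finrank_cubicTwo hθ) (M₀ := 3) (B₀ := 3) (by norm_num)
    (fun ℓ hℓ hB hdvd v hv => cubicTwo_splitData hθ ℓ hℓ hB hdvd v hv)

end Summit.Langlands.Langlands.Cruxes.MonomialSerreAtSplitPrimes.Disproof

end
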